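import Summits.ResolutionOfSingularities.ResolutionOfSingularities.Theorems.EquisingularLiftEquisingularLiftNatDirStepUnobsOfCharts
import Summits.ResolutionOfSingularities.ResolutionOfSingularities.Theorems.EquisingularLiftEquisingularLiftNatSpecimenWhitneyCubicCiNose
import Literature.AlgebraicGeometry.Motives.ProjectiveSpaceLinearSubspaces
import Literature.AlgebraicGeometry.Motives.ReducedClosedSubschemeIso
import Summits.ResolutionOfSingularities.ResolutionOfSingularities.Theorems.EquisingularLiftEquisingularLiftNatLinearCentrePoints
import Literature.AlgebraicGeometry.Resolution.ProjHomogeneousIdealSheaf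
import Literature.AlgebraicGeometry.Motives.VarietiesProjectiveSpaceProofs
import Literature.AlgebraicGeometry.Resolution.QuasiRegularSequences
import Literature.AlgebraicGeometry.Resolution.RegularCentreLocal
import Literature.AlgebraicGeometry.Resolution.MvPolynomialKillVars
import HarnessLib

/-!
# [OURS · L1 W4.5(b) · EL♮(3) · nose residue / NEST centres, brick N-8, part 1/2: the ring-level twisted splitting] EVERY COORDINATE LINE `V₊(x₂, …, x_{m+1}) ⊂ ℙ^{m+1}_K` HAS
# UNOBSTRUCTED EMBEDDED DEFORMATIONS: `DirStepUnobs ℙ^{m+1} univ _ Λ` for all `m` (`𝒩 = 𝒪(1)^m`; `m = 1`: a line in the plane)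

Cell `res-hironaka`, LADDER-RESOLUTION rung L (D-0089), slot W4.5(b), crux chain w45b: child crux **EL♮(3)** =
stmt-ResolutionOfSingularities-20148, parent EL♮ = stmt-…-20038. WIDTH seat res-L1-w45b-nose-w1 g2 (D-0157 DOOR 1), free-hand brick N-8
(STATUS 2026-08-28T19:28Z), the all-`m` generalisation of N-1 (b) ✓ p658502 / ✓ p659452 (`m = 2`, the double line of ℙ³). Customers: the
NEST-centre shape of R39 (i) «an irreducible regular curve in the fresh plane `E_q ≅ ℙ²` with `DirStepUnobs`» when the centre is a LINE
(`m = 1`, through res-L1-w45b-iso-w2's ✓ D3-10 `dirStepUnobs_of_model_iso` and res-L1-w45b-iso-w4's linear automorphisms `…NatProjLinearAut` for an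
arbitrary line), and every nose certificate along a coordinate line of `ℙ^{m+1}`. `--supports stmt-ResolutionOfSingularities-20148 --as helper`.
OURS; NOT a statement of H. Hironaka's 2017 manuscript (nothing of [Hironaka2017] is asserted); AI-written, AI review weaker than expert review.
DEFINITION-FREE (local `notation3` abbreviations only); no `sorry`; standard axioms. EL♮(3) is NOT proved here; resolution in positive characteristic
is NOT proved here (dimension 3 is Cossart–Piltant 2008/2009 in print).

WHAT. `PnLine.dirStepUnobs_coordLine (K) [Field K] (m : ℕ) : DirStepUnobs (Proj K[x₀,…,x_{m+1}]) Set.univ isClosed_univ Λ _`,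
`Λ = {y | x₂, …, x_{m+1} ∈ 𝔭_y} = V₊(x₂, …, x_{m+1})` — obtained from the twisted producer ✓ p655133 `dirStepUnobs_univ_of_two_charts` with: charts
`D₊(x₀)`, `D₊(x₁)` (affine, affine overlap `D₊(x₀x₁)`, covering `Λ` since a relevant prime containing `x₂, …, x_{m+1}` misses `x₀` or `x₁`);
generators `(x_{k+2}/xᵢ)_{k<m}` read through Mathlib's `Proj.awayToSection`, quasi-regular by transport of the regular sequence `(y₁, …, y_m)` of
`K[y₀, …, y_m]` (`isWeaklyRegular_map_X`, `isQuasiRegular_of_isWeaklyRegular`, `IsQuasiRegular.map_ringEquiv`, `ProjectiveSpace.chartAlgEquiv`); the ideal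
`𝓘⟨Λ⟩ = ker Proj(f_K)` for the kill map `f_K : K[x₀..x_{m+1}] → K[x₀, x₁]` (NEW here for all `m`: `range_projMap_kill_eq_coordLine` — the range of
the closed immersion `ℙ¹ ↪ ℙ^{m+1}` is `Λ`, via the generic point `(x₂, …, x_{m+1})` = Literature `coordSubspacePoint` and `closure_coordSubspacePoint`;
`ker_projMap_kill_eq_vanishingIdeal_coordLine` by `ker_eq_vanishingIdeal_of_isReduced`), whose chart sections are `(ker f_K)_{(xᵢ)} = (x_{k+2}/xᵢ)`
(Literature `ker_projMap_ideal_basicOpen`, `awayIdeal_span_eq`, `LinearCentre.ker_kill`); transition `M = (x₁/x₀)·1`; and the TWISTED SPLITTING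
`exists_split` (part 1/2): every degree-zero fraction of `(K[x]_{x₀x₁})₀` is `a| + (x₁/x₀)·b|` modulo `(ker f_K)_{(x₀x₁)}` — `H¹(ℙ¹, 𝒪(1)) = 0` monomial
by monomial. Part 1/2 = `…NatProjectiveSpaceCoordLineSplitting` (ring level), part 2/2 = `…NatProjectiveSpaceCoordLineDirStepUnobs` (sections,
charts, ideal, assembly). INDEX CONVENTION: the grading lives on `Fin (1 + m + 1)` (the kill map's `Fin (r + m + 1)`, `r = 1`); the generator index
`k : Fin m` enters as `⟨k+1, _⟩ : Fin (1 + m)` (chart variable) and `⟨k+2, _⟩ : Fin (1 + m + 1)` (homogeneous variable), since `Fin (m + 1)` and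
`Fin (1 + m)` are not definitionally equal.

References (method / index only): R. Hartshorne, *Algebraic Geometry* (1977), II Prop. 2.5, II Prop. 5.11 (proof), II Ex. 3.12, III Thm. 5.1
[cite: Hartshorne1977]; The Stacks Project, Tag 01ED [cite: StacksProject].
-/

set_option linter.dupNamespace false -- mandated namespace `Summit.<Summit>.<Problem>` of this single-conjunct summit

noncomputable section

-- `TopCat.Presheaf`/`Scheme.Modules` are not reducible (as in Mathlib's `AlgebraicGeometry/Modules`).
set_option backward.isDefEq.respectTransparency false

open CategoryTheory CategoryTheory.Limits AlgebraicGeometry TopologicalSpace Opposite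
open MvPolynomial HomogeneousLocalization
open Literature.AlgebraicGeometry.Resolution
open Literature.AlgebraicGeometry.Motives

namespace Summit.ResolutionOfSingularities.ResolutionOfSingularities.Cruxes.EquisingularLiftNat.Sections

namespace PnLine

variable (K : Type) [Field K] (m : ℕ)

attribute [local instance] MvPolynomial.gradedAlgebra ProjBaseChange.algebraBase

local notation "𝒜" => MvPolynomial.homogeneousSubmodule (Fin (1 + m + 1)) K
local notation "A4" => MvPolynomial (Fin (1 + m + 1)) K

/-! ## §1 Algebra in the degree-zero localisations `(K[x]_{x₀})₀`, `(K[x]_{x₁})₀`, `(K[x]_{x₀x₁})₀` -/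

/-- `x₀x₁` is homogeneous of degree `2`. -/
theorem X01_mem : (X 0 * X 1 : MvPolynomial (Fin (1 + m + 1)) K) ∈ 𝒜 2 :=
  SetLike.mul_mem_graded (ProjectiveSpace.X_mem (R := K) 0) (ProjectiveSpace.X_mem (R := K) 1)

/-- `x₁²` is homogeneous of degree `1 • 2`. -/
theorem X_one_sq_mem : (X 1 ^ 2 : MvPolynomial (Fin (1 + m + 1)) K) ∈ 𝒜 (1 • 2) := by
  simpa using (isHomogeneous_X K (1 : Fin (1 + m + 1))).pow 2

/-! Local abbreviations (notation only; the file stays definition-free): the restrictions `res₀ : (K[x]_{x₀})₀ → (K[x]_{x₀x₁})₀`,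
`res₁ : (K[x]_{x₁})₀ → (K[x]_{x₀x₁})₀` (Mathlib `HomogeneousLocalization.awayMap`), the transition function `tEl = x₁/x₀ = x₁²/(x₀x₁)`,
Mathlib's section isomorphism `aTS[s] : (K[x]_s)₀ → Γ(ℙ³, D₊(s))` (`Proj.awayToSection`), the affine charts `U[i] = D₊(xᵢ)`, the chart sections
`gens[i] = (x_{i⁺1}/xᵢ, x_{i⁺2}/xᵢ)` (`i⁺ = i.succAbove`; for `i = 0, 1` these are `(x₂/xᵢ, x₃/xᵢ)`), and `kerKill[f]` the kernel of a graded map. -/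
local notation3 "res₀" => HomogeneousLocalization.awayMap (MvPolynomial.homogeneousSubmodule (Fin (1 + m + 1)) K) (ProjectiveSpace.X_mem (R := K) (1 : Fin (1 + m + 1)))
  (rfl : (X 0 * X 1 : MvPolynomial (Fin (1 + m + 1)) K) = X 0 * X 1)
local notation3 "res₁" => HomogeneousLocalization.awayMap (MvPolynomial.homogeneousSubmodule (Fin (1 + m + 1)) K) (ProjectiveSpace.X_mem (R := K) (0 : Fin (1 + m + 1)))
  (mul_comm (X 0 : MvPolynomial (Fin (1 + m + 1)) K) (X 1))
local notation3 "tEl" => HomogeneousLocalization.Away.mk (MvPolynomial.homogeneousSubmodule (Fin (1 + m + 1)) K) (X01_mem K m) 1 (X 1 ^ 2 : MvPolynomial (Fin (1 + m + 1)) K) (X_one_sq_mem K m)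
local notation3 "aTS[" s "]" => CommRingCat.Hom.hom (Proj.awayToSection (MvPolynomial.homogeneousSubmodule (Fin (1 + m + 1)) K) s)
local notation3 "U[" i "]" => ProjSubscheme.affineBasicOpen (MvPolynomial.homogeneousSubmodule (Fin (1 + m + 1)) K) (X i : MvPolynomial (Fin (1 + m + 1)) K)
  (ProjectiveSpace.X_mem (R := K) i) one_pos
local notation3 "gens[" i "]" => fun k : Fin m =>
  CommRingCat.Hom.hom (Proj.awayToSection (MvPolynomial.homogeneousSubmodule (Fin (1 + m + 1)) K) (X i : MvPolynomial (Fin (1 + m + 1)) K)) (ProjectiveSpace.chartGen K i (⟨(k : ℕ) + 1, by omega⟩ : Fin (1 + m)))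
local notation3 "kerKill[" f "]" => RingHom.ker (R := MvPolynomial (Fin (1 + m + 1)) K) (S := MvPolynomial (Fin (1 + 1)) K) f

/-- A homogeneous polynomial's monomials are homogeneous of the same degree. -/
theorem monomial_coeff_mem {N : ℕ} {p : A4} (hp : p ∈ 𝒜 N) (α : Fin (1 + m + 1) →₀ ℕ) (hα : α ∈ p.support) :
    monomial α (coeff α p) ∈ 𝒜 N := by
  rw [mem_homogeneousSubmodule] at hp ⊢
  refine isHomogeneous_monomial _ ?_
  rw [Finsupp.degree_eq_weight_one]
  exact hp (mem_support_iff.mp hα)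

/-- **Decomposition of a degree-zero fraction into monomial fractions** (same denominator). -/
theorem awayMk_eq_sum_monomial {s : A4} {d : ℕ} (hs : s ∈ 𝒜 d) (N : ℕ) (p : A4) (hp : p ∈ 𝒜 (N • d)) :
    HomogeneousLocalization.Away.mk 𝒜 hs N p hp =
      ∑ α ∈ p.support.attach, HomogeneousLocalization.Away.mk 𝒜 hs N (monomial α.1 (coeff α.1 p)) (monomial_coeff_mem K m hp α.1 α.2) := by
  apply HomogeneousLocalization.val_injective
  rw [← HomogeneousLocalization.algebraMap_apply, ← HomogeneousLocalization.algebraMap_apply, map_sum]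
  simp only [HomogeneousLocalization.algebraMap_apply, HomogeneousLocalization.Away.val_mk]
  rw [← Localization.mk_sum]
  congr 1
  conv_lhs => rw [p.as_sum]
  exact (Finset.sum_attach p.support (fun α => monomial α (coeff α p))).symm

/-- `C c · x₁ⁿ` is homogeneous of degree `n`. -/
theorem C_mul_X_pow_mem (c : K) (i : Fin (1 + m + 1)) (n : ℕ) : (C c * X i ^ n : A4) ∈ 𝒜 (n • 1) := by
  simpa using isHomogeneous_C_mul_X_pow c i n

/-- `C c · x₀ⁱ x₁ʲ` is homogeneous of degree `i + j`. -/
theorem C_mul_X_pow_mul_X_pow_mem (c : K) (i j N : ℕ) (hij : i + j = 2 * N) :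
    (C c * X 0 ^ i * X 1 ^ j : MvPolynomial (Fin (1 + m + 1)) K) ∈ 𝒜 (N • 2) := by
  have h := (isHomogeneous_C_mul_X_pow c (0 : Fin (1 + m + 1)) i).mul ((isHomogeneous_X K (1 : Fin (1 + m + 1))).pow j)
  rw [mem_homogeneousSubmodule]
  convert h using 1
  simp [smul_eq_mul]; omega

/-- (M2a) `c x₀ⁱ x₁ʲ / (x₀x₁)ᵐ = (c (x₁/x₀)^{j-N})|` when `j ≥ N`. -/
theorem monFrac_eq_res₀ (c : K) (i j N : ℕ) (hij : i + j = 2 * N) (hjm : N ≤ j) :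
    HomogeneousLocalization.Away.mk 𝒜 (X01_mem K m) N (C c * X 0 ^ i * X 1 ^ j) (C_mul_X_pow_mul_X_pow_mem K m c i j N hij) =
      res₀ (HomogeneousLocalization.Away.mk 𝒜 (ProjectiveSpace.X_mem (R := K) 0) (j - N) (C c * X 1 ^ (j - N))
        (C_mul_X_pow_mem K m c 1 (j - N))) := by
  rw [awayMap_mk]
  apply HomogeneousLocalization.val_injective
  simp only [HomogeneousLocalization.Away.val_mk]
  rw [Localization.mk_eq_mk_iff]
  refine Localization.r_of_eq ?_
  simp only [mul_pow]
  obtain ⟨e, rfl⟩ := Nat.exists_eq_add_of_le hjm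
  obtain rfl : N = i + e := by omega
  simp only [Nat.add_sub_cancel_left]
  ring

/-- (M2b) `c x₀ⁱ x₁ʲ / (x₀x₁)ᵐ = t · (c (x₀/x₁)^{i-N+1})|` when `j < N`. -/
theorem monFrac_eq_tEl_mul_res₁ (c : K) (i j N : ℕ) (hij : i + j = 2 * N) (hjm : j < N) :
    HomogeneousLocalization.Away.mk 𝒜 (X01_mem K m) N (C c * X 0 ^ i * X 1 ^ j) (C_mul_X_pow_mul_X_pow_mem K m c i j N hij) =
      tEl * res₁ (HomogeneousLocalization.Away.mk 𝒜 (ProjectiveSpace.X_mem (R := K) 1) (i - N + 1) (C c * X 0 ^ (i - N + 1))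
        (C_mul_X_pow_mem K m c 0 (i - N + 1))) := by
  rw [awayMap_mk, Literature.AlgebraicGeometry.Resolution.Away.mk_mul_mk]
  apply HomogeneousLocalization.val_injective
  simp only [HomogeneousLocalization.Away.val_mk]
  rw [Localization.mk_eq_mk_iff]
  refine Localization.r_of_eq ?_
  simp only [mul_pow]
  have hj : j = 2 * N - i := by omega
  subst hj
  obtain ⟨e, rfl⟩ := Nat.exists_eq_add_of_le (show N + 1 ≤ i by omega)
  simp only [show N + 1 + e - N + 1 = e + 2 by omega, show 2 * N - (N + 1 + e) = N - 1 - e by omega]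
  obtain ⟨N', rfl⟩ := Nat.exists_eq_add_of_le (show e + 1 ≤ N by omega)
  simp only [show e + 1 + N' - 1 - e = N' by omega]
  ring

section Kill

variable (fk : MvPolynomial.homogeneousSubmodule (Fin (1 + m + 1)) K →+*ᵍ MvPolynomial.homogeneousSubmodule (Fin (1 + 1)) K)
  (hfkX : ∀ i : Fin (1 + m + 1), fk (X i) = if h : (i : ℕ) < 1 + 1 then X ⟨i, h⟩ else 0)

include hfkX in
/-- (M1) The kill map annihilates every monomial involving `x₂` or `x₃`. -/
theorem kill_monomial_eq_zero (α : Fin (1 + m + 1) →₀ ℕ) (c : K) (h : ∃ i : Fin (1 + m + 1), 1 + 1 ≤ (i : ℕ) ∧ α i ≠ 0) :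
    fk (monomial α c) = 0 := by
  obtain ⟨i, hi, h⟩ := h
  rw [monomial_eq, map_mul, Finsupp.prod, map_prod,
    Finset.prod_eq_zero (Finsupp.mem_support_iff.mpr h) (by rw [map_pow, hfkX, dif_neg (by omega), zero_pow h]), mul_zero]

/-- Every index of `Fin (m + 2)` is `0`, `1` or `k + 2`. -/
theorem fin_cases_two (i : Fin (1 + m + 1)) : i = 0 ∨ i = 1 ∨ ∃ k : Fin m, i = (⟨(k : ℕ) + 2, by omega⟩ : Fin (1 + m + 1)) := by
  obtain ⟨i, hi⟩ := i
  rcases i with _ | _ | j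
  · exact Or.inl rfl
  · exact Or.inr (Or.inl (Fin.ext (by simp [Nat.mod_eq_of_lt (show 1 < 1 + m + 1 by omega)])))
  · exact Or.inr (Or.inr ⟨⟨j, by omega⟩, Fin.ext (by simp)⟩)

/-- A finitely supported function on `Fin (m + 2)` vanishing at the indices `≥ 2` is `single 0 (α 0) + single 1 (α 1)`. -/
theorem finsupp_eq_single_add_single (α : Fin (1 + m + 1) →₀ ℕ) (h2 : ∀ i : Fin (1 + m + 1), 1 + 1 ≤ (i : ℕ) → α i = 0) :
    α = Finsupp.single 0 (α 0) + Finsupp.single 1 (α 1) := by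
  ext i
  rcases fin_cases_two m i with rfl | rfl | ⟨k, rfl⟩
  · simp
  · simp
  · have hk : α (⟨(k : ℕ) + 2, by omega⟩ : Fin (1 + m + 1)) = 0 := h2 _ (by simp)
    rw [Finsupp.add_apply, Finsupp.single_eq_of_ne (by simp [Fin.ext_iff]),
      Finsupp.single_eq_of_ne (by simp [Fin.ext_iff, Nat.mod_eq_of_lt (show 1 < 1 + m + 1 by omega)]), hk, add_zero]

/-- The degree bookkeeping: a monomial of degree `2m` supported on `{x₀, x₁}` has `α 0 + α 1 = 2m`. -/
theorem deg_eq_of_mem {N : ℕ} {α : Fin (1 + m + 1) →₀ ℕ} {c : K} (hc : c ≠ 0) (hmem : (monomial α c : A4) ∈ 𝒜 (N • 2))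
    (h2 : ∀ i : Fin (1 + m + 1), 1 + 1 ≤ (i : ℕ) → α i = 0) : α 0 + α 1 = 2 * N := by
  rw [mem_homogeneousSubmodule] at hmem
  have h := hmem (d := α) (by rwa [coeff_monomial, if_pos rfl])
  have hdeg : (Finsupp.degree : (Fin (1 + m + 1) →₀ ℕ) →+ ℕ) α = α 0 + α 1 := by
    conv_lhs => rw [finsupp_eq_single_add_single m α h2]
    rw [map_add, Finsupp.degree_single, Finsupp.degree_single]
  have h1 : (Finsupp.weight (1 : Fin (1 + m + 1) → ℕ)) α = (Finsupp.degree : (Fin (1 + m + 1) →₀ ℕ) →+ ℕ) α := by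
    rw [Finsupp.degree_eq_weight_one]; rfl
  rw [h1, hdeg, smul_eq_mul] at h
  omega

/-- A monomial supported on `{x₀, x₁}` is `C c · x₀ⁱ x₁ʲ`. -/
theorem monomial_eq_C_mul_X_pow (α : Fin (1 + m + 1) →₀ ℕ) (c : K) (h2 : ∀ i : Fin (1 + m + 1), 1 + 1 ≤ (i : ℕ) → α i = 0) :
    (monomial α c : A4) = C c * X 0 ^ (α 0) * X 1 ^ (α 1) := by
  conv_lhs => rw [finsupp_eq_single_add_single m α h2]
  rw [show c = c * 1 from (mul_one c).symm, ← monomial_mul, ← C_mul_X_pow_eq_monomial, ← C_mul_X_pow_eq_monomial, mul_one,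
    map_one, one_mul]

/-- The splitting predicate is preserved by `0`. -/
theorem good_zero : ∃ (a : Away 𝒜 (X 0 : A4)) (b : Away 𝒜 (X 1 : A4)),
    (0 : Away 𝒜 (X 0 * X 1 : A4)) - (res₀ a + tEl * res₁ b) ∈ awayIdeal 𝒜 (X01_mem K m) (kerKill[fk]) := ⟨0, 0, by simp⟩

/-- The splitting predicate is additive. -/
theorem good_add {z z' : Away 𝒜 (X 0 * X 1 : A4)}
    (hz : ∃ (a : Away 𝒜 (X 0 : A4)) (b : Away 𝒜 (X 1 : A4)), z - (res₀ a + tEl * res₁ b) ∈ awayIdeal 𝒜 (X01_mem K m) (kerKill[fk]))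
    (hz' : ∃ (a : Away 𝒜 (X 0 : A4)) (b : Away 𝒜 (X 1 : A4)), z' - (res₀ a + tEl * res₁ b) ∈ awayIdeal 𝒜 (X01_mem K m) (kerKill[fk])) :
    ∃ (a : Away 𝒜 (X 0 : A4)) (b : Away 𝒜 (X 1 : A4)), (z + z') - (res₀ a + tEl * res₁ b) ∈ awayIdeal 𝒜 (X01_mem K m) (kerKill[fk]) := by
  obtain ⟨a, b, h⟩ := hz
  obtain ⟨a', b', h'⟩ := hz'
  refine ⟨a + a', b + b', ?_⟩
  have := Ideal.add_mem _ h h'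
  convert this using 1
  simp only [map_add]
  ring


include hfkX in
/-- ★ **THE TWISTED SPLITTING in `(K[x]_{x₀x₁})₀` modulo `(x₂, x₃)`**: every degree-zero fraction `z` is `a| + (x₁/x₀)·b|` modulo
`(ker f_K)_{(x₀x₁)}`, with `a ∈ (K[x]_{x₀})₀`, `b ∈ (K[x]_{x₁})₀` (`Ȟ¹(ℙ¹, 𝒪(1)) = 0` monomial by monomial). -/
theorem exists_split (z : Away 𝒜 (X 0 * X 1 : A4)) :
    ∃ (a : Away 𝒜 (X 0 : A4)) (b : Away 𝒜 (X 1 : A4)), z - (res₀ a + tEl * res₁ b) ∈ awayIdeal 𝒜 (X01_mem K m) (kerKill[fk]) := by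
  classical
  obtain ⟨N, p, hp, rfl⟩ := HomogeneousLocalization.Away.mk_surjective 𝒜 (X01_mem K m) z
  rw [awayMk_eq_sum_monomial]
  refine Finset.sum_induction _
    (fun z => ∃ (a : Away 𝒜 (X 0 : A4)) (b : Away 𝒜 (X 1 : A4)), z - (res₀ a + tEl * res₁ b) ∈ awayIdeal 𝒜 (X01_mem K m) (kerKill[fk]))
    (fun _ _ => good_add K m fk) (good_zero K m fk) ?_
  rintro ⟨α, hα⟩ -
  by_cases h : ∃ i : Fin (1 + m + 1), 1 + 1 ≤ (i : ℕ) ∧ α i ≠ 0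
  · exact ⟨0, 0, by simpa using mk_mem_awayIdeal 𝒜 (X01_mem K m) _ (RingHom.mem_ker.mpr (kill_monomial_eq_zero K m fk hfkX α _ h))⟩
  · push Not at h
    have h2 : ∀ i : Fin (1 + m + 1), 1 + 1 ≤ (i : ℕ) → α i = 0 := h
    have hc : coeff α p ≠ 0 := mem_support_iff.mp hα
    have hdeg := deg_eq_of_mem K m hc (monomial_coeff_mem K m hp α hα) h2
    have heq : HomogeneousLocalization.Away.mk 𝒜 (X01_mem K m) N (monomial α (coeff α p)) (monomial_coeff_mem K m hp α hα) =
        HomogeneousLocalization.Away.mk 𝒜 (X01_mem K m) N (C (coeff α p) * X 0 ^ (α 0) * X 1 ^ (α 1))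
          (C_mul_X_pow_mul_X_pow_mem K m (coeff α p) (α 0) (α 1) N hdeg) := by
      simp only [monomial_eq_C_mul_X_pow K m α (coeff α p) h2]
    change ∃ a b, HomogeneousLocalization.Away.mk 𝒜 (X01_mem K m) N (monomial α (coeff α p)) (monomial_coeff_mem K m hp α hα) - _ ∈ _
    rw [heq]
    by_cases hjm : N ≤ α 1
    · rw [monFrac_eq_res₀ K m _ _ _ _ hdeg hjm]
      exact ⟨HomogeneousLocalization.Away.mk 𝒜 (ProjectiveSpace.X_mem (R := K) 0) (α 1 - N) (C (coeff α p) * X 1 ^ (α 1 - N))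
        (C_mul_X_pow_mem K m _ 1 _), 0, by simp⟩
    · rw [monFrac_eq_tEl_mul_res₁ K m _ _ _ _ hdeg (lt_of_not_ge hjm)]
      exact ⟨0, HomogeneousLocalization.Away.mk 𝒜 (ProjectiveSpace.X_mem (R := K) 1) (α 0 - N + 1) (C (coeff α p) * X 0 ^ (α 0 - N + 1))
        (C_mul_X_pow_mem K m _ 0 _), by simp⟩

end Kill

end PnLine

end Summit.ResolutionOfSingularities.ResolutionOfSingularities.Cruxes.EquisingularLiftNat.Sections

end
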